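import Literature.Probability.RandomPlanarGeometry.HexSAWBrickWallStripFugacityWidthOneLinearContactCLT
import Literature.Probability.Moments.FiniteTiltModerateDeviations
import Literature.Analysis.Asymptotics.UniformQuadraticTiltExpansion
import HarnessLib

/-!
# Moderate deviations of EVERY linear contact statistic `v₁·bc + v₂·tc` of the width-one two-wall strip

Topic `Literature/Probability/RandomPlanarGeometry` (continues `…WidthOneLinearContactCLT.lean` (the Gaussian mgf / Cramér–Wold CLT of `L = v₁bc + v₂tc`,
`m_v = v₁b + v₂b'`, curvature `H_{y,z}(v)` = the free-energy Hessian `contactHess`), `…WidthOneContactModerateDeviations(Lower).lean` (CAR 33/42: the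
bottom-wall case `v = (1,0)` by hand) and the two model-free engines `Literature/Analysis/Asymptotics/UniformQuadraticTiltExpansion.lean` (uniform two-term
asymptotics + `C²` free energy ⇒ the UNIFORM QUADRATIC EXPANSION «UQE») and `Literature/Probability/Moments/FiniteTiltModerateDeviations.lean` (UQE ⇒ MDP)).
THIS FILE is the instance along an ARBITRARY line of log-fugacities:

* §1 ★★★ `abs_log_linMGF_sub_le` — THE LOG-MGF EXPANSION ALONG LINES, UNIFORM IN THE TILT: for every `η > 0` there is `δ > 0` such that for all large `N`
  and ALL `|s| ≤ δ√N`, `|log (C_{1,N}(ye^{sv₁/√N}, ze^{sv₂/√N})/C_{1,N}(y,z)·e^{−s√N m_v}) − H(v)s²/2| ≤ ηs² + η` (the engine fed with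
  `contDiff_two_log_stripMuY₂_line`, `contDiff_two_parityG_line` and the rectangle remainder `exists_uniform_log_two_term_rect`); `lin_uqe` restates it on
  the weights `wgt·e^{tL}`.
* §2 ★★★ THE MODERATE DEVIATIONS OF `L` for every `v ≠ 0`, every `x_N → ∞` with `x_N/√N → 0` and every `η > 0`, eventually:
  `e^{−(1+η)x_N²/(2H(v))} ≤ P_{N,y,z}(L ≥ N m_v + x_N√N) ≤ e^{−(1−η)x_N²/(2H(v))}` and the same for `P_{N,y,z}(L ≤ N m_v − x_N√N)`
  (`eventually_linUpperTail_le_exp_moderate`, `eventually_exp_le_linUpperTail_moderate`, `…linLowerTail…`), and ★★★ THE MDP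
  `x_N^{-2} log P_{N,y,z}(L ≷ N m_v ± x_N√N) → −1/(2H_{y,z}(v))` (`tendsto_log_linUpperTail_div_sq`, `tendsto_log_linLowerTail_div_sq`).
* §3 the named special cases: the TOP-wall contact number (`v = (0,1)`, rate `1/(2·∂b(e^B,y)/∂B)`) and the TOTAL number of surface contacts
  (`v = (1,1)`, rate `1/(2H(1,1))`); the bottom wall `v = (1,0)` recovers CAR 33/42 (`contactHess_axes`).

## Sources
A. Dembo, O. Zeitouni, *Large Deviations Techniques and Applications* (2010) §2.3, §3.7 (lane statements); N. R. Beaton, M. Bousquet-Mélou, J. de Gier,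
H. Duminil-Copin, A. J. Guttmann, CMP 326 (2014), arXiv:1109.0358v5 §3.2 Proposition 6 (p. 10: the weights `y^{bc} z^{tc}`); E. J. Janse van Rensburg (2000)
§3.3.  Nothing is quoted AS PRINTED; statements and constants are this lineage's (lane «pcv-sawmu», a-p5 g27).
-/

noncomputable section

open Filter Topology Finset Set Literature.Analysis Literature.Analysis.Asymptotics Literature.Probability.Moments
open Literature.Probability.LatticeModels Literature.Probability.Percolation

namespace Literature.Probability.RandomPlanarGeometry.SAW.HexBW

namespace WidthOneYZ

variable {y z : ℝ}

/-! ## §1 ★★★ The log-mgf expansion along lines, uniform in the tilt -/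

/-- ★★★ **THE LOG-MGF EXPANSION ALONG LINES, UNIFORM IN THE TILT**: for `y, z > 0`, every direction `(v₁,v₂)` and every `η > 0` there is `δ > 0` such that
for all large `N` and ALL real `s` with `|s| ≤ δ√N`,
`|log (C_{1,N}(y e^{s v₁/√N}, z e^{s v₂/√N})/C_{1,N}(y,z) · e^{−s√N m_v}) − H_{y,z}(v)·s²/2| ≤ η s² + η`, `m_v = v₁ b(y,z) + v₂ b(z,y)` — the model-free
`uniform_quadratic_expansion_of_two_term` run on the line free energy (`contDiff_two_log_stripMuY₂_line`), the line amplitude corrections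
(`contDiff_two_parityG_line`) and the rectangle remainder (`exists_uniform_log_two_term_rect`).  CAR 33's `abs_log_contactMGF_sub_le` is the case `v = (1,0)`.
[cite: DemboZeitouni2010, §2.3 (local expansion of the logarithmic mgf; lane statement); BeatonBousquetMelouDeGierDuminilCopinGuttmann2014, §3.2 Proposition 6 (arXiv v5 p. 10)] -/
theorem abs_log_linMGF_sub_le (hy : 0 < y) (hz : 0 < z) (v₁ v₂ : ℝ) {η : ℝ} (hη : 0 < η) :
    ∃ δ : ℝ, 0 < δ ∧ ∀ᶠ N : ℕ in atTop, ∀ s : ℝ, |s| ≤ δ * Real.sqrt N →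
      |Real.log (stripZ₂ 1 N (y * Real.exp (s / Real.sqrt N * v₁)) (z * Real.exp (s / Real.sqrt N * v₂)) / stripZ₂ 1 N y z
          * Real.exp (-(s * Real.sqrt N * (v₁ * contactB y z + v₂ * contactB z y))))
        - contactHess v₁ v₂ y z * s ^ 2 / 2| ≤ η * s ^ 2 + η := by
  set A₀ := Real.log y with hA₀
  set B₀ := Real.log z with hB₀
  have hyA : Real.exp A₀ = y := Real.exp_log hy
  have hzB : Real.exp B₀ = z := Real.exp_log hz
  -- the data of the model-free theorem
  set F : ℕ → ℝ → ℝ := fun N t => Real.log (stripZ₂ 1 N (Real.exp (A₀ + t * v₁)) (Real.exp (B₀ + t * v₂))) with hF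
  set Λ : ℝ → ℝ := fun t => Real.log (stripMuY₂ 1 (Real.exp (A₀ + t * v₁)) (Real.exp (B₀ + t * v₂))) with hΛ
  set Λ₁ : ℝ → ℝ := fun t => v₁ * contactB (Real.exp (A₀ + t * v₁)) (Real.exp (B₀ + t * v₂))
      + v₂ * contactB (Real.exp (B₀ + t * v₂)) (Real.exp (A₀ + t * v₁)) with hΛ₁
  set Λ₂ : ℝ → ℝ := fun t => contactHess v₁ v₂ (Real.exp (A₀ + t * v₁)) (Real.exp (B₀ + t * v₂)) with hΛ₂
  obtain ⟨-, hΛd, hΛdd, hΛ2c⟩ := contDiff_two_log_stripMuY₂_line A₀ B₀ v₁ v₂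
  set g : ℕ → ℝ → ℝ := fun c t => Real.log (parityAmplitude c (Real.exp (A₀ + t * v₁)) (Real.exp (B₀ + t * v₂))) with hg
  have hgc : ∀ c < 2, ContinuousAt (g c) 0 := by
    intro c hc
    have hG2 := contDiff_two_parityG_line A₀ B₀ v₁ v₂ hc
    have hΛc : Continuous Λ := (contDiff_two_log_stripMuY₂_line A₀ B₀ v₁ v₂).1.continuous
    have e : g c = fun t => ((c : ℝ) * Real.log (stripMuY₂ 1 (Real.exp (A₀ + t * v₁)) (Real.exp (B₀ + t * v₂)))
        + Real.log (parityAmplitude c (Real.exp (A₀ + t * v₁)) (Real.exp (B₀ + t * v₂)))) - (c : ℝ) * Λ t := by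
      funext t; simp only [hg, hΛ]; ring
    rw [e]
    exact (hG2.continuous.sub (continuous_const.mul hΛc)).continuousAt
  -- the rectangle remainders on `[e^{A₀−|v₁|}, e^{A₀+|v₁|}] × [e^{B₀−|v₂|}, e^{B₀+|v₂|}]`
  set y₁ := Real.exp (A₀ - |v₁|) with hy₁def
  set y₂ := Real.exp (A₀ + |v₁|) with hy₂def
  set z₁ := Real.exp (B₀ - |v₂|) with hz₁def
  set z₂ := Real.exp (B₀ + |v₂|) with hz₂def
  have hy₁ : 0 < y₁ := Real.exp_pos _
  have hz₁ : 0 < z₁ := Real.exp_pos _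
  have h12 : y₁ ≤ y₂ := Real.exp_le_exp.2 (by linarith [abs_nonneg v₁])
  have hz12 : z₁ ≤ z₂ := Real.exp_le_exp.2 (by linarith [abs_nonneg v₂])
  have hrem : ∀ c, c < 2 → ∃ ε : ℕ → ℝ, Tendsto ε atTop (𝓝 0) ∧ ∀ M : ℕ, ∀ y' ∈ Icc y₁ y₂, ∀ z' ∈ Icc z₁ z₂,
      |Real.log (stripZ₂ 1 (2 * M + c) y' z') - (2 * M + c) * Real.log (stripMuY₂ 1 y' z') - Real.log (parityAmplitude c y' z')| ≤ ε M := by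
    intro c hc
    obtain ⟨a₁, a₂, ha₁, hA⟩ := parityAmplitude_bounds_rect hy₁ h12 hz₁ hz12 hc
    obtain ⟨ε, hεlim, hεb⟩ := exists_uniform_log_two_term_rect hy₁ h12 hz₁ hz12 hc ha₁ hA
      (fun y' hy' z' hz' => tendsto_parityAmplitude (lt_of_lt_of_le hy₁ hy'.1) (lt_of_lt_of_le hz₁ hz'.1) hc)
    refine ⟨ε, ?_, hεb⟩
    have hε0 : ∀ M, 0 ≤ ε M := fun M => le_trans (abs_nonneg _) (hεb M y₁ ⟨le_rfl, h12⟩ z₁ ⟨le_rfl, hz12⟩)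
    refine squeeze_zero' (Filter.Eventually.of_forall hε0) ?_ hεlim
    filter_upwards [eventually_ge_atTop 1] with M hM
    have hM1' : (1 : ℝ) ≤ M := by exact_mod_cast hM
    nlinarith [hε0 M]
  obtain ⟨ε0, hε0lim, hε0b⟩ := hrem 0 (by norm_num)
  obtain ⟨ε1, hε1lim, hε1b⟩ := hrem 1 (by norm_num)
  have hmemI : ∀ w : ℝ, |w| ≤ 1 → Real.exp (A₀ + w * v₁) ∈ Icc y₁ y₂ ∧ Real.exp (B₀ + w * v₂) ∈ Icc z₁ z₂ := by
    intro w hw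
    have b1 : |w * v₁| ≤ |v₁| := by
      rw [abs_mul]; exact (mul_le_mul_of_nonneg_right hw (abs_nonneg _)).trans (by rw [one_mul])
    have b2 : |w * v₂| ≤ |v₂| := by
      rw [abs_mul]; exact (mul_le_mul_of_nonneg_right hw (abs_nonneg _)).trans (by rw [one_mul])
    obtain ⟨b1l, b1u⟩ := abs_le.1 b1
    obtain ⟨b2l, b2u⟩ := abs_le.1 b2
    exact ⟨⟨Real.exp_le_exp.2 (by linarith), Real.exp_le_exp.2 (by linarith)⟩,
      ⟨Real.exp_le_exp.2 (by linarith), Real.exp_le_exp.2 (by linarith)⟩⟩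
  set ε : ℕ → ℝ := fun M => |ε0 M| + |ε1 M| with hεdef
  have hε : Tendsto ε atTop (𝓝 0) := by
    have c0 := hε0lim.abs
    have c1 := hε1lim.abs
    simp only [abs_zero] at c0 c1
    have := c0.add c1
    rwa [add_zero] at this
  have hremF : ∀ c < 2, ∀ M : ℕ, ∀ t : ℝ, |t| ≤ 1 → |F (2 * M + c) t - ((2 * M + c : ℕ) : ℝ) * Λ t - g c t| ≤ ε M := by
    intro c hc M t ht
    obtain ⟨hmy, hmz⟩ := hmemI t ht
    have hcast : ((2 * M + c : ℕ) : ℝ) = 2 * (M : ℝ) + (c : ℝ) := by push_cast; ring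
    have hbound : |Real.log (stripZ₂ 1 (2 * M + c) (Real.exp (A₀ + t * v₁)) (Real.exp (B₀ + t * v₂)))
        - (2 * (M : ℝ) + c) * Real.log (stripMuY₂ 1 (Real.exp (A₀ + t * v₁)) (Real.exp (B₀ + t * v₂)))
        - Real.log (parityAmplitude c (Real.exp (A₀ + t * v₁)) (Real.exp (B₀ + t * v₂)))| ≤ ε M := by
      have h0 : ε0 M ≤ ε M := (le_abs_self _).trans (le_add_of_nonneg_right (abs_nonneg _))
      have h1 : ε1 M ≤ ε M := (le_abs_self _).trans (le_add_of_nonneg_left (abs_nonneg _))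
      interval_cases c
      · exact (hε0b M _ hmy _ hmz).trans h0
      · exact (hε1b M _ hmy _ hmz).trans h1
    simpa only [hF, hΛ, hg, hcast] using hbound
  obtain ⟨δ, hδ, hev⟩ := uniform_quadratic_expansion_of_two_term (p := 2) (by norm_num) one_pos hΛd hΛdd hΛ2c.continuousAt hgc hε hremF hη
  refine ⟨δ, hδ, ?_⟩
  filter_upwards [hev, eventually_ge_atTop 1] with N hN hN1 s hs
  have key := hN s hs
  have hNr : (0 : ℝ) < N := by exact_mod_cast hN1
  -- identify the pieces
  have hΛ₁0 : Λ₁ 0 = v₁ * contactB y z + v₂ * contactB z y := by simp only [hΛ₁, zero_mul, add_zero, hyA, hzB]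
  have hΛ₂0 : Λ₂ 0 = contactHess v₁ v₂ y z := by simp only [hΛ₂, zero_mul, add_zero, hyA, hzB]
  have ept : ∀ t, y * Real.exp (t * v₁) = Real.exp (A₀ + t * v₁) ∧ z * Real.exp (t * v₂) = Real.exp (B₀ + t * v₂) := fun t => by
    constructor <;> rw [Real.exp_add] <;> simp [hyA, hzB]
  obtain ⟨ey, ez⟩ := ept (s / Real.sqrt N)
  have hC1 := stripZ₂_pos 1 N (mul_pos hy (Real.exp_pos (s / Real.sqrt N * v₁))) (mul_pos hz (Real.exp_pos (s / Real.sqrt N * v₂)))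
  have hC0 := stripZ₂_pos 1 N hy hz
  have hF1 : F N (s / Real.sqrt N) = Real.log (stripZ₂ 1 N (y * Real.exp (s / Real.sqrt N * v₁)) (z * Real.exp (s / Real.sqrt N * v₂))) := by
    simp only [hF, ey, ez]
  have hF0 : F N 0 = Real.log (stripZ₂ 1 N y z) := by
    simp only [hF, zero_mul, add_zero, hyA, hzB]
  have hlog : Real.log (stripZ₂ 1 N (y * Real.exp (s / Real.sqrt N * v₁)) (z * Real.exp (s / Real.sqrt N * v₂)) / stripZ₂ 1 N y z
        * Real.exp (-(s * Real.sqrt N * (v₁ * contactB y z + v₂ * contactB z y))))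
      = F N (s / Real.sqrt N) - F N 0 - s * Real.sqrt N * Λ₁ 0 := by
    rw [Real.log_mul (div_pos hC1 hC0).ne' (Real.exp_pos _).ne', Real.log_div hC1.ne' hC0.ne', Real.log_exp, hF1, hF0, hΛ₁0]
    ring
  rw [hlog, ← hΛ₂0]
  exact key

open Classical in
/-- The same expansion, restated on the finite exponential family `q ↦ wgt_{y,z}(q)·e^{tL(q)}`, `L = v₁bc + v₂tc` — literally the «UQE» hypothesis of
`Literature.Probability.Moments.eventually_upperTail_le_exp_of_uqe` with scale `√N`, centring `N m_v` and curvature `H_{y,z}(v)`.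
[cite: DemboZeitouni2010, §2.3 (lane statement)] -/
theorem lin_uqe (hy : 0 < y) (hz : 0 < z) (v₁ v₂ : ℝ) :
    ∀ η : ℝ, 0 < η → ∃ δ : ℝ, 0 < δ ∧ ∀ᶠ N : ℕ in atTop, ∀ s : ℝ, |s| ≤ δ * Real.sqrt N →
      |Real.log ((∑ q ∈ stripPairs 1 N, wgt y z N q
            * Real.exp (s / Real.sqrt N * (v₁ * (bottomVisits₀ q.1 q.2 N : ℝ) + v₂ * (topVisits₀ 1 q.1 q.2 N : ℝ))))
          / ∑ q ∈ stripPairs 1 N, wgt y z N q)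
        - s * ((N : ℝ) * (v₁ * contactB y z + v₂ * contactB z y)) / Real.sqrt N - contactHess v₁ v₂ y z * s ^ 2 / 2| ≤ η * s ^ 2 + η := by
  intro η hη
  obtain ⟨δ, hδ, hev⟩ := abs_log_linMGF_sub_le hy hz v₁ v₂ hη
  refine ⟨δ, hδ, ?_⟩
  filter_upwards [hev, eventually_ge_atTop 1] with N hN hN1 s hs
  have key := hN s hs
  have hNr : (0 : ℝ) < N := by exact_mod_cast hN1
  have hsq : 0 < Real.sqrt (N : ℝ) := Real.sqrt_pos.2 hNr
  have hC1 := stripZ₂_pos 1 N (mul_pos hy (Real.exp_pos (s / Real.sqrt N * v₁))) (mul_pos hz (Real.exp_pos (s / Real.sqrt N * v₂)))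
  have hC0 := stripZ₂_pos 1 N hy hz
  rw [← stripZ₂_one_tilt₂_eq_sum, ← stripZ₂_one_eq_sum_wgt]
  have e1 : s * ((N : ℝ) * (v₁ * contactB y z + v₂ * contactB z y)) / Real.sqrt N
      = s * Real.sqrt N * (v₁ * contactB y z + v₂ * contactB z y) := by
    rw [div_eq_iff hsq.ne']
    linear_combination (-(s * (v₁ * contactB y z + v₂ * contactB z y))) * Real.mul_self_sqrt hNr.le
  rw [e1]
  rw [Real.log_mul (div_pos hC1 hC0).ne' (Real.exp_pos _).ne', Real.log_exp] at key
  convert key using 2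
  ring

/-! ## §2 ★★★ Moderate deviations of every linear contact statistic -/

open Classical in
/-- ★★★ **MODERATE DEVIATIONS OF `L = v₁bc + v₂tc`, UPPER TAIL, UPPER BOUND**: for `y, z > 0`, `v ≠ 0`, every `x_N → ∞` with `x_N/√N → 0` and every `η > 0`,
eventually `P_{N,y,z}(L ≥ N m_v + x_N√N) ≤ exp(−(1−η)x_N²/(2H_{y,z}(v)))`. [cite: DemboZeitouni2010, §3.7 (moderate deviations; lane statement)] -/
theorem eventually_linUpperTail_le_exp_moderate (hy : 0 < y) (hz : 0 < z) {v₁ v₂ : ℝ} (hv : (v₁, v₂) ≠ (0, 0)) {x : ℕ → ℝ}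
    (hx : Tendsto x atTop atTop) (hxN : Tendsto (fun N => x N / Real.sqrt N) atTop (𝓝 0)) {η : ℝ} (hη : 0 < η) :
    ∀ᶠ N : ℕ in atTop,
      (∑ q ∈ (stripPairs 1 N).filter (fun q => (N : ℝ) * (v₁ * contactB y z + v₂ * contactB z y) + x N * Real.sqrt N
          ≤ v₁ * (bottomVisits₀ q.1 q.2 N : ℝ) + v₂ * (topVisits₀ 1 q.1 q.2 N : ℝ)), wgt y z N q) / stripZ₂ 1 N y z
        ≤ Real.exp (-((1 - η) * x N ^ 2 / (2 * contactHess v₁ v₂ y z))) := by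
  have h := eventually_upperTail_le_exp_of_uqe (l := atTop) (fun N => stripPairs 1 N) (fun N q => wgt y z N q)
    (fun N q => v₁ * (bottomVisits₀ q.1 q.2 N : ℝ) + v₂ * (topVisits₀ 1 q.1 q.2 N : ℝ)) (fun N => Real.sqrt N)
    (fun N => (N : ℝ) * (v₁ * contactB y z + v₂ * contactB z y)) (contactHess v₁ v₂ y z) (contactHess_pos hy hz hv)
    (Eventually.of_forall fun N q _ => wgt_nonneg hy.le hz.le N q)
    (Eventually.of_forall fun N => by rw [← stripZ₂_one_eq_sum_wgt]; exact stripZ₂_pos 1 N hy hz)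
    ((eventually_ge_atTop 1).mono fun N hN => Real.sqrt_pos.2 (by exact_mod_cast hN)) (lin_uqe hy hz v₁ v₂) hx hxN hη
  simpa only [← stripZ₂_one_eq_sum_wgt] using h

open Classical in
/-- ★★★ **MODERATE DEVIATIONS OF `L`, LOWER TAIL, UPPER BOUND**: eventually `P_{N,y,z}(L ≤ N m_v − x_N√N) ≤ exp(−(1−η)x_N²/(2H_{y,z}(v)))`.
[cite: DemboZeitouni2010, §3.7 (moderate deviations; lane statement)] -/
theorem eventually_linLowerTail_le_exp_moderate (hy : 0 < y) (hz : 0 < z) {v₁ v₂ : ℝ} (hv : (v₁, v₂) ≠ (0, 0)) {x : ℕ → ℝ}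
    (hx : Tendsto x atTop atTop) (hxN : Tendsto (fun N => x N / Real.sqrt N) atTop (𝓝 0)) {η : ℝ} (hη : 0 < η) :
    ∀ᶠ N : ℕ in atTop,
      (∑ q ∈ (stripPairs 1 N).filter (fun q => v₁ * (bottomVisits₀ q.1 q.2 N : ℝ) + v₂ * (topVisits₀ 1 q.1 q.2 N : ℝ)
          ≤ (N : ℝ) * (v₁ * contactB y z + v₂ * contactB z y) - x N * Real.sqrt N), wgt y z N q) / stripZ₂ 1 N y z
        ≤ Real.exp (-((1 - η) * x N ^ 2 / (2 * contactHess v₁ v₂ y z))) := by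
  have h := eventually_lowerTail_le_exp_of_uqe (l := atTop) (fun N => stripPairs 1 N) (fun N q => wgt y z N q)
    (fun N q => v₁ * (bottomVisits₀ q.1 q.2 N : ℝ) + v₂ * (topVisits₀ 1 q.1 q.2 N : ℝ)) (fun N => Real.sqrt N)
    (fun N => (N : ℝ) * (v₁ * contactB y z + v₂ * contactB z y)) (contactHess v₁ v₂ y z) (contactHess_pos hy hz hv)
    (Eventually.of_forall fun N q _ => wgt_nonneg hy.le hz.le N q)
    (Eventually.of_forall fun N => by rw [← stripZ₂_one_eq_sum_wgt]; exact stripZ₂_pos 1 N hy hz)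
    ((eventually_ge_atTop 1).mono fun N hN => Real.sqrt_pos.2 (by exact_mod_cast hN)) (lin_uqe hy hz v₁ v₂) hx hxN hη
  simpa only [← stripZ₂_one_eq_sum_wgt] using h

open Classical in
/-- ★★★ **MODERATE DEVIATIONS OF `L`, UPPER TAIL, LOWER BOUND**: eventually `exp(−(1+η)x_N²/(2H_{y,z}(v))) ≤ P_{N,y,z}(L ≥ N m_v + x_N√N)` (Cramér's change of
measure at the moderate tilt, via the model-free engine). [cite: DemboZeitouni2010, §2.3 (Gärtner–Ellis lower bound) and §3.7; lane statement] -/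
theorem eventually_exp_le_linUpperTail_moderate (hy : 0 < y) (hz : 0 < z) {v₁ v₂ : ℝ} (hv : (v₁, v₂) ≠ (0, 0)) {x : ℕ → ℝ}
    (hx : Tendsto x atTop atTop) (hxN : Tendsto (fun N => x N / Real.sqrt N) atTop (𝓝 0)) {η : ℝ} (hη : 0 < η) :
    ∀ᶠ N : ℕ in atTop, Real.exp (-((1 + η) * x N ^ 2 / (2 * contactHess v₁ v₂ y z)))
      ≤ (∑ q ∈ (stripPairs 1 N).filter (fun q => (N : ℝ) * (v₁ * contactB y z + v₂ * contactB z y) + x N * Real.sqrt N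
          ≤ v₁ * (bottomVisits₀ q.1 q.2 N : ℝ) + v₂ * (topVisits₀ 1 q.1 q.2 N : ℝ)), wgt y z N q) / stripZ₂ 1 N y z := by
  have h := eventually_exp_le_upperTail_of_uqe (l := atTop) (fun N => stripPairs 1 N) (fun N q => wgt y z N q)
    (fun N q => v₁ * (bottomVisits₀ q.1 q.2 N : ℝ) + v₂ * (topVisits₀ 1 q.1 q.2 N : ℝ)) (fun N => Real.sqrt N)
    (fun N => (N : ℝ) * (v₁ * contactB y z + v₂ * contactB z y)) (contactHess v₁ v₂ y z) (contactHess_pos hy hz hv)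
    (Eventually.of_forall fun N q _ => wgt_nonneg hy.le hz.le N q)
    (Eventually.of_forall fun N => by rw [← stripZ₂_one_eq_sum_wgt]; exact stripZ₂_pos 1 N hy hz)
    ((eventually_ge_atTop 1).mono fun N hN => Real.sqrt_pos.2 (by exact_mod_cast hN)) (lin_uqe hy hz v₁ v₂) hx hxN hη
  simpa only [← stripZ₂_one_eq_sum_wgt] using h

open Classical in
/-- ★★★ **MODERATE DEVIATIONS OF `L`, LOWER TAIL, LOWER BOUND**: eventually `exp(−(1+η)x_N²/(2H_{y,z}(v))) ≤ P_{N,y,z}(L ≤ N m_v − x_N√N)`.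
[cite: DemboZeitouni2010, §2.3 (Gärtner–Ellis lower bound) and §3.7; lane statement] -/
theorem eventually_exp_le_linLowerTail_moderate (hy : 0 < y) (hz : 0 < z) {v₁ v₂ : ℝ} (hv : (v₁, v₂) ≠ (0, 0)) {x : ℕ → ℝ}
    (hx : Tendsto x atTop atTop) (hxN : Tendsto (fun N => x N / Real.sqrt N) atTop (𝓝 0)) {η : ℝ} (hη : 0 < η) :
    ∀ᶠ N : ℕ in atTop, Real.exp (-((1 + η) * x N ^ 2 / (2 * contactHess v₁ v₂ y z)))
      ≤ (∑ q ∈ (stripPairs 1 N).filter (fun q => v₁ * (bottomVisits₀ q.1 q.2 N : ℝ) + v₂ * (topVisits₀ 1 q.1 q.2 N : ℝ)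
          ≤ (N : ℝ) * (v₁ * contactB y z + v₂ * contactB z y) - x N * Real.sqrt N), wgt y z N q) / stripZ₂ 1 N y z := by
  have h := eventually_exp_le_lowerTail_of_uqe (l := atTop) (fun N => stripPairs 1 N) (fun N q => wgt y z N q)
    (fun N q => v₁ * (bottomVisits₀ q.1 q.2 N : ℝ) + v₂ * (topVisits₀ 1 q.1 q.2 N : ℝ)) (fun N => Real.sqrt N)
    (fun N => (N : ℝ) * (v₁ * contactB y z + v₂ * contactB z y)) (contactHess v₁ v₂ y z) (contactHess_pos hy hz hv)
    (Eventually.of_forall fun N q _ => wgt_nonneg hy.le hz.le N q)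
    (Eventually.of_forall fun N => by rw [← stripZ₂_one_eq_sum_wgt]; exact stripZ₂_pos 1 N hy hz)
    ((eventually_ge_atTop 1).mono fun N hN => Real.sqrt_pos.2 (by exact_mod_cast hN)) (lin_uqe hy hz v₁ v₂) hx hxN hη
  simpa only [← stripZ₂_one_eq_sum_wgt] using h

open Classical in
/-- ★★★ **THE MODERATE DEVIATION PRINCIPLE FOR EVERY LINEAR CONTACT STATISTIC, upper tail**: for `y, z > 0`, `v ≠ 0` and every `x_N → ∞` with
`x_N/√N → 0`: `x_N^{-2} · log P_{N,y,z}(v₁bc + v₂tc ≥ N m_v + x_N√N) → −1/(2H_{y,z}(v))` — at every scale strictly between the CLT scale `√N` and the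
LDP scale `N`, with the rate given by the free-energy Hessian. [cite: DemboZeitouni2010, §3.7 Theorem 3.7.1 (moderate deviations; lane statement)] -/
theorem tendsto_log_linUpperTail_div_sq (hy : 0 < y) (hz : 0 < z) {v₁ v₂ : ℝ} (hv : (v₁, v₂) ≠ (0, 0)) {x : ℕ → ℝ}
    (hx : Tendsto x atTop atTop) (hxN : Tendsto (fun N => x N / Real.sqrt N) atTop (𝓝 0)) :
    Tendsto (fun N : ℕ => Real.log ((∑ q ∈ (stripPairs 1 N).filter (fun q =>
        (N : ℝ) * (v₁ * contactB y z + v₂ * contactB z y) + x N * Real.sqrt N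
          ≤ v₁ * (bottomVisits₀ q.1 q.2 N : ℝ) + v₂ * (topVisits₀ 1 q.1 q.2 N : ℝ)), wgt y z N q) / stripZ₂ 1 N y z) / x N ^ 2)
      atTop (𝓝 (-(1 / (2 * contactHess v₁ v₂ y z)))) := by
  have h := tendsto_log_upperTail_div_sq_of_uqe (l := atTop) (fun N => stripPairs 1 N) (fun N q => wgt y z N q)
    (fun N q => v₁ * (bottomVisits₀ q.1 q.2 N : ℝ) + v₂ * (topVisits₀ 1 q.1 q.2 N : ℝ)) (fun N => Real.sqrt N)
    (fun N => (N : ℝ) * (v₁ * contactB y z + v₂ * contactB z y)) (contactHess v₁ v₂ y z) (contactHess_pos hy hz hv)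
    (Eventually.of_forall fun N q _ => wgt_nonneg hy.le hz.le N q)
    (Eventually.of_forall fun N => by rw [← stripZ₂_one_eq_sum_wgt]; exact stripZ₂_pos 1 N hy hz)
    ((eventually_ge_atTop 1).mono fun N hN => Real.sqrt_pos.2 (by exact_mod_cast hN)) (lin_uqe hy hz v₁ v₂) hx hxN
  simpa only [← stripZ₂_one_eq_sum_wgt] using h

open Classical in
/-- ★★★ **THE MODERATE DEVIATION PRINCIPLE FOR EVERY LINEAR CONTACT STATISTIC, lower tail**:
`x_N^{-2} · log P_{N,y,z}(v₁bc + v₂tc ≤ N m_v − x_N√N) → −1/(2H_{y,z}(v))`. [cite: DemboZeitouni2010, §3.7 Theorem 3.7.1 (moderate deviations; lane statement)] -/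
theorem tendsto_log_linLowerTail_div_sq (hy : 0 < y) (hz : 0 < z) {v₁ v₂ : ℝ} (hv : (v₁, v₂) ≠ (0, 0)) {x : ℕ → ℝ}
    (hx : Tendsto x atTop atTop) (hxN : Tendsto (fun N => x N / Real.sqrt N) atTop (𝓝 0)) :
    Tendsto (fun N : ℕ => Real.log ((∑ q ∈ (stripPairs 1 N).filter (fun q =>
        v₁ * (bottomVisits₀ q.1 q.2 N : ℝ) + v₂ * (topVisits₀ 1 q.1 q.2 N : ℝ)
          ≤ (N : ℝ) * (v₁ * contactB y z + v₂ * contactB z y) - x N * Real.sqrt N), wgt y z N q) / stripZ₂ 1 N y z) / x N ^ 2)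
      atTop (𝓝 (-(1 / (2 * contactHess v₁ v₂ y z)))) := by
  have h := tendsto_log_lowerTail_div_sq_of_uqe (l := atTop) (fun N => stripPairs 1 N) (fun N q => wgt y z N q)
    (fun N q => v₁ * (bottomVisits₀ q.1 q.2 N : ℝ) + v₂ * (topVisits₀ 1 q.1 q.2 N : ℝ)) (fun N => Real.sqrt N)
    (fun N => (N : ℝ) * (v₁ * contactB y z + v₂ * contactB z y)) (contactHess v₁ v₂ y z) (contactHess_pos hy hz hv)
    (Eventually.of_forall fun N q _ => wgt_nonneg hy.le hz.le N q)
    (Eventually.of_forall fun N => by rw [← stripZ₂_one_eq_sum_wgt]; exact stripZ₂_pos 1 N hy hz)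
    ((eventually_ge_atTop 1).mono fun N hN => Real.sqrt_pos.2 (by exact_mod_cast hN)) (lin_uqe hy hz v₁ v₂) hx hxN
  simpa only [← stripZ₂_one_eq_sum_wgt] using h

/-! ## §3 The named special cases: the top wall and the total number of surface contacts -/

open Classical in
/-- ★★ **THE MDP OF THE TOP-WALL CONTACT NUMBER**: `x_N^{-2} · log P_{N,y,z}(tc ≥ N b(z,y) + x_N√N) → −1/(2·∂b(e^B,y)/∂B|_{B = log z})`
(`v = (0,1)`; `H(0,1)` identified by `contactHess_axes`). [cite: DemboZeitouni2010, §3.7 Theorem 3.7.1 (moderate deviations; lane statement)] -/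
theorem tendsto_log_topContactUpperTail_div_sq (hy : 0 < y) (hz : 0 < z) {x : ℕ → ℝ}
    (hx : Tendsto x atTop atTop) (hxN : Tendsto (fun N => x N / Real.sqrt N) atTop (𝓝 0)) :
    Tendsto (fun N : ℕ => Real.log ((∑ q ∈ (stripPairs 1 N).filter (fun q =>
        (N : ℝ) * contactB z y + x N * Real.sqrt N ≤ (topVisits₀ 1 q.1 q.2 N : ℝ)), wgt y z N q) / stripZ₂ 1 N y z) / x N ^ 2)
      atTop (𝓝 (-(1 / (2 * deriv (fun B => contactB (Real.exp B) y) (Real.log z))))) := by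
  have h := tendsto_log_linUpperTail_div_sq hy hz (v₁ := 0) (v₂ := 1) (by simp) hx hxN
  rw [← (contactHess_axes hy hz).2.1]
  refine h.congr' (Eventually.of_forall fun N => ?_)
  have e : ((stripPairs 1 N).filter fun q => (N : ℝ) * (0 * contactB y z + 1 * contactB z y) + x N * Real.sqrt N
        ≤ 0 * (bottomVisits₀ q.1 q.2 N : ℝ) + 1 * (topVisits₀ 1 q.1 q.2 N : ℝ))
      = (stripPairs 1 N).filter fun q => (N : ℝ) * contactB z y + x N * Real.sqrt N ≤ (topVisits₀ 1 q.1 q.2 N : ℝ) :=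
    Finset.filter_congr fun q _ => by simp only [zero_mul, zero_add, one_mul]
  simp only [e]

open Classical in
/-- ★★ **THE MDP OF THE TOTAL NUMBER OF SURFACE CONTACTS**: `x_N^{-2} · log P_{N,y,z}(bc + tc ≥ N(b + b') + x_N√N) → −1/(2H_{y,z}(1,1))`.
[cite: DemboZeitouni2010, §3.7 Theorem 3.7.1 (moderate deviations; lane statement)] -/
theorem tendsto_log_totalContactUpperTail_div_sq (hy : 0 < y) (hz : 0 < z) {x : ℕ → ℝ}
    (hx : Tendsto x atTop atTop) (hxN : Tendsto (fun N => x N / Real.sqrt N) atTop (𝓝 0)) :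
    Tendsto (fun N : ℕ => Real.log ((∑ q ∈ (stripPairs 1 N).filter (fun q =>
        (N : ℝ) * (contactB y z + contactB z y) + x N * Real.sqrt N
          ≤ (bottomVisits₀ q.1 q.2 N : ℝ) + (topVisits₀ 1 q.1 q.2 N : ℝ)), wgt y z N q) / stripZ₂ 1 N y z) / x N ^ 2)
      atTop (𝓝 (-(1 / (2 * contactHess 1 1 y z)))) := by
  have h := tendsto_log_linUpperTail_div_sq hy hz (v₁ := 1) (v₂ := 1) (by simp) hx hxN
  refine h.congr' (Eventually.of_forall fun N => ?_)
  have e : ((stripPairs 1 N).filter fun q => (N : ℝ) * (1 * contactB y z + 1 * contactB z y) + x N * Real.sqrt N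
        ≤ 1 * (bottomVisits₀ q.1 q.2 N : ℝ) + 1 * (topVisits₀ 1 q.1 q.2 N : ℝ))
      = (stripPairs 1 N).filter fun q => (N : ℝ) * (contactB y z + contactB z y) + x N * Real.sqrt N
        ≤ (bottomVisits₀ q.1 q.2 N : ℝ) + (topVisits₀ 1 q.1 q.2 N : ℝ) :=
    Finset.filter_congr fun q _ => by simp only [one_mul]
  simp only [e]

end WidthOneYZ

end Literature.Probability.RandomPlanarGeometry.SAW.HexBW
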